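import Summits.AnomalousDissipation.AnomalousDissipation.Theorems.SolenoidalFractalHomogenisationLagrangianStepSidebandCrushedResponse
import Summits.AnomalousDissipation.AnomalousDissipation.Theorems.SolenoidalFractalHomogenisationLagrangianStepSidebandLadderCrushStretch
import Summits.AnomalousDissipation.AnomalousDissipation.Theorems.SolenoidalFractalHomogenisationLagrangianStepSidebandMeanSlot
import Summits.AnomalousDissipation.AnomalousDissipation.Theorems.SolenoidalFractalHomogenisationRealisedQuasiStaticCellLawSlotWindows
import HarnessLib

/-!
# K1L_D `stub_D1_V0thg` (stmt-AnomalousDissipation-27980), R3′ lane, R3′-2 engine brick: THE ν-CRUSHED PERIODIC RESPONSE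
# (the crushed-response fixed point `…SidebandCrushedResponse` fed with the landed single-ladder crush `ladder_crush_quasistatic_nu`)

Helper file of route `SolenoidalFractalHomogenisation` (`--supports stmt-AnomalousDissipation-27980 --as helper`; one-generation hand
`leafhand-ad-solenoidalfractalh-1` g1, road E-c).  `Sideband.norm_responseExt_le_of_ladderCrush'` (fixed-point argument) takes an ABSTRACT crush
hypothesis for the two ladders `± m_j + ℤmᵢ` on a one-slot window `[s, e]`; `Sideband.ladder_crush_quasistatic_nu` (R3′-1, one ladder, the slot window
`[startᵢ, startᵢ + τᵢ/r³]` of the quasi-statically stretched word `W.stretch (1/r³)`, `ν = r³`) is the landed engine.  This file packages the latter into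
the former's shape and composes:
* §1 `gen_add_int_mul_period` (the truncated generator is `P`-periodic, integer multiples); `slotEnvelope_eq_zero_of_mem_slot_Icc` (on the CLOSED window
  of slot `i` every other envelope vanishes — right end point included) and its period-shifted form;
* §2 **`ladderCrush_pair_shifted`** — for a word `W`, a slot `i` HOPPING the fibres `± m_j` (`êᵢ·m_j ≠ 0`) and a feasible window shape `(l, h, β)`:
  ν-free constants `K, C_R > 0` such that for every admissible `R, r ≤ 1, 𝔸 ∈ NearIso(r³l, r³h) ∩ OddSmall(r³β), γ₁ ≥ 0`, every INTEGER PERIOD SHIFT `p`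
  and BOTH base points `z₀ = ± m_j`, every solution on the shifted slot window from the ladder subspace of `z₀ + ℤmᵢ` is crushed by `K·r³` (squared norms)
  — `ladder_crush_quasistatic_nu` twice (the coupling constant `a = 2π|êᵢ·z₀|‖αᵢ‖` is the same for `± m_j`) + the time shift `t ↦ t + pP`;
* §3 **`norm_responseExt_le_crushed_nu`** — THE ν-CRUSHED PERIODIC RESPONSE of source slot `j` of the stretched word `W₁ = W.stretch (1/r³)`: with
  `s = start¹ᵢ + pP¹`, `e = s + τ¹ᵢ`, a source time `a ≤ s` with `e ≤ a + P¹`, static links on `[a, s)` and the source off on `[s, a + P¹]`,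
  `‖N̄ e v‖ ≤ 2√(K r³)/(1 − θ)·‖N̄ s v‖` for any `θ < 1` above `e^{−min(γ₁,4π²r³l)(P¹ − τ¹ᵢ)}`.
What is NOT here: the cubature-word bookkeeping (`W = cubatureWord.stretch MB`, the static-slot census `SidebandPathCensus`, the choice of `p`, `a` per
slot pair, `θ` ν-free from `viscRate_mul_slotLen`) and the per-pair table = `D1TailCrushBound`.  No definitions, no sorry.  NOT a proof of `stub_D1_V0thg`,
of K1L_D or of AD; rung F-D1.A0 infrastructure.
-/

set_option linter.dupNamespace false -- single-conjunct summit: `Summit.AnomalousDissipation.AnomalousDissipation.…` is the mandated namespace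

noncomputable section

namespace Summit.AnomalousDissipation.AnomalousDissipation.Theorems.SolenoidalFractalHomogenisation.LagrangianStep.Sideband

open Set Complex MeasureTheory
open scoped InnerProductSpace
open Literature.Analysis Literature.Analysis.FunctionSpaces Literature.Analysis.FunctionSpaces.Torus
open Literature.Analysis.FluidPDE Literature.Analysis.FluidPDE.Torus Literature.Analysis.FluidPDE.LatticeShear
open Summit.AnomalousDissipation.AnomalousDissipation.Theorems.SolenoidalFractalHomogenisation.LagrangianStep.CellChain (linkCoeff)
open Summit.AnomalousDissipation.AnomalousDissipation.Theorems.SolenoidalFractalHomogenisation.PermissibleCarrier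
  (period_pos start_nonneg start_add_tau_le_period)
open Summit.AnomalousDissipation.AnomalousDissipation.Theorems.SolenoidalFractalHomogenisation.RealisedQuasiStaticCellLaw (start_add_tau_le_start)

variable {k₀ : ℕ}

/-! ## §1 Period shifts -/

/-- The truncated generator is `P`-periodic: integer multiples. [cite: MajdaKramer1999, §2.2.1.3 (cell problem (49))] -/
theorem gen_add_int_mul_period (W₁ : LatticeWord k₀) (𝔸 : Torus.Visc4 (Fin 3)) (γ₁ : ℝ) (R : ℕ) (t : ℝ) (p : ℤ) :
    gen W₁ 𝔸 γ₁ R (t + p * W₁.period) = gen W₁ 𝔸 γ₁ R t := by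
  induction p using Int.induction_on generalizing t with
  | zero => simp
  | succ n ih =>
    rw [show t + ((n : ℤ) + 1 : ℤ) * W₁.period = (t + (n : ℤ) * W₁.period) + W₁.period by push_cast; ring, gen_add_period, ih]
  | pred n ih =>
    have h := gen_add_period W₁ 𝔸 γ₁ R (t + (-(n : ℤ) - 1 : ℤ) * W₁.period)
    rw [show t + ((-(n : ℤ) - 1 : ℤ) : ℝ) * W₁.period + W₁.period = t + ((-(n : ℤ) : ℤ) : ℝ) * W₁.period by push_cast; ring, ih] at h
    exact h.symm

/-- **On the CLOSED window of slot `i` every other envelope vanishes** (right end point included: the next slot's trapezoid starts from `0`).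
[cite: ArmstrongVicol2025, §3 (time cut-offs)] -/
theorem slotEnvelope_eq_zero_of_mem_slot_Icc (W₁ : LatticeWord k₀) {i l : Fin k₀} (hl : l ≠ i) {t : ℝ}
    (ht : t ∈ Icc (W₁.start i) (W₁.start i + (W₁.phase i).τ)) : slotEnvelope W₁ l t = 0 := by
  rcases lt_or_eq_of_le ht.2 with h | h
  · exact slotEnvelope_eq_zero_of_mem_slot W₁ hl ⟨ht.1, h⟩
  · rcases lt_or_gt_of_ne hl with hli | hil
    · exact slotEnvelope_eq_zero_of_end_le W₁ l ((start_add_tau_le_start W₁ hli).trans ht.1) (h ▸ start_add_tau_le_period W₁ i)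
    · exact slotEnvelope_eq_zero_of_le_start W₁ l ((start_nonneg W₁ i).trans ht.1) (h ▸ start_add_tau_le_start W₁ hil)

/-- The same on the window of slot `i` shifted by `p` periods. [cite: ArmstrongVicol2025, §3 (time cut-offs)] -/
theorem slotEnvelope_eq_zero_of_mem_shifted_slot_Icc (W₁ : LatticeWord k₀) {i l : Fin k₀} (hl : l ≠ i) (p : ℤ) {t : ℝ}
    (ht : t ∈ Icc (W₁.start i + p * W₁.period) (W₁.start i + p * W₁.period + (W₁.phase i).τ)) : slotEnvelope W₁ l t = 0 := by
  have h := slotEnvelope_eq_zero_of_mem_slot_Icc W₁ hl (t := t + (-p : ℤ) * W₁.period)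
    ⟨by push_cast; linarith [ht.1], by push_cast; linarith [ht.2]⟩
  rwa [slotEnvelope_add_int_mul_period] at h


/-! ## §2 The crush of BOTH ladders `± m_j + ℤmᵢ`, on any period-shifted window of slot `i` -/

/-- The ladder coupling of `−z₀` is that of `z₀`. [cite: MeshalkinSinai1961, pp. 1700–1705] -/
theorem sum_e_mul_neg (W : LatticeWord k₀) (i : Fin k₀) (z₀ : Fin 3 → ℤ) :
    ∑ a, (W.phase i).e a * ((-z₀) a : ℝ) = -∑ a, (W.phase i).e a * (z₀ a : ℝ) := by
  simp only [Pi.neg_apply, Int.cast_neg, mul_neg, Finset.sum_neg_distrib]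

/-- **THE PAIR CRUSH, PERIOD-SHIFTED.**  For a word `W`, a slot `i` hopping the fibres `± m_j` (`êᵢ·m_j ≠ 0`), `|mᵢ|_∞ ≤ M`, and a feasible window
shape `(l, h, β)` (feasibility `128(β(1+Mo)/(2l))² ≤ S₀` in the coupling `a = 2π|êᵢ·m_j|‖αᵢ‖`): ν-FREE constants `K, C_R > 0` such that for every
truncation `R > M`, every `r ∈ (0,1]` with `C_R ≤ (R − M)r²` and `2r² ≤ τᵢ`, every `𝔸 ∈ NearIso(r³l, r³h) ∩ OddSmall(r³β)`, `γ₁ ≥ 0`, every integer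
period shift `p` and both base points `z₀ = ± m_j`: a solution `u′ = gen(t) u` of the stretched word `W.stretch (1/r³)` on the shifted window
`[start¹ᵢ + pP¹, start¹ᵢ + pP¹ + τᵢ/r³]` starting in the ladder subspace of `z₀ + ℤmᵢ` obeys `‖u(end)‖² ≤ K·r³·‖u(start)‖²`.
[cite: BedrossianCotiZelati2017, §2 (hypocoercivity, enhanced dissipation)] -/
theorem ladderCrush_pair_shifted (W : LatticeWord k₀) (i j : Fin k₀)
    (hhop : ∑ a, (W.phase i).e a * ((W.phase j).m a : ℝ) ≠ 0) {M : ℝ} (hM : ∀ c, |((W.phase i).m c : ℝ)| ≤ M)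
    {l h β : ℝ} (hl : 0 < l) (hh : 0 < h) (hβ : 0 ≤ β)
    {a m₂ S₀ Mo : ℝ} (ha : a = 2 * Real.pi * |∑ a, (W.phase i).e a * ((W.phase j).m a : ℝ)| * ‖slotAmp W i‖)
    (hm₂ : m₂ = freqNormSq (W.phase i).m)
    (hS₀ : S₀ = 4 * (4 * a ^ 2) + 16 * (8 * a ^ 2 * (1 + m₂) * h / l) + 1) (hMo : Mo = 8 * a ^ 2 * (1 + m₂))
    (hF : 128 * (β / (2 * l) * (1 + Mo)) ^ 2 ≤ S₀) :
    ∃ K CR : ℝ, 0 < K ∧ 0 < CR ∧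
      ∀ {R : ℕ}, M < R → ∀ {r : ℝ} (hr : 0 < r), r ≤ 1 → CR ≤ ((R : ℝ) - M) * r ^ 2 → 2 * r ^ 2 ≤ (W.phase i).τ →
      ∀ {𝔸 : Torus.Visc4 (Fin 3)}, Torus.NearIso 𝔸 (r ^ 3 * l) (r ^ 3 * h) → Torus.OddSmall 𝔸 (r ^ 3 * β) → ∀ {γ₁ : ℝ}, 0 ≤ γ₁ →
      ∀ (p : ℤ) (z₀ : Fin 3 → ℤ), (z₀ = (W.phase j).m ∨ z₀ = -(W.phase j).m) → ∀ u : ℝ → Space R,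
        (∀ t ∈ Icc ((W.stretch (1 / r ^ 3) (by positivity)).start i + p * (W.stretch (1 / r ^ 3) (by positivity)).period)
            ((W.stretch (1 / r ^ 3) (by positivity)).start i + p * (W.stretch (1 / r ^ 3) (by positivity)).period + 1 / r ^ 3 * (W.phase i).τ),
          HasDerivAt u (((gen (W.stretch (1 / r ^ 3) (by positivity)) 𝔸 γ₁ R t).restrictScalars ℝ) (u t)) t) →
        u ((W.stretch (1 / r ^ 3) (by positivity)).start i + p * (W.stretch (1 / r ^ 3) (by positivity)).period) ∈
          ladderSub R (ladder z₀ (W.phase i).m) →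
        ‖u ((W.stretch (1 / r ^ 3) (by positivity)).start i + p * (W.stretch (1 / r ^ 3) (by positivity)).period + 1 / r ^ 3 * (W.phase i).τ)‖ ^ 2 ≤
          K * r ^ 3 * ‖u ((W.stretch (1 / r ^ 3) (by positivity)).start i + p * (W.stretch (1 / r ^ 3) (by positivity)).period)‖ ^ 2 := by
  -- the two single-ladder crushes (same coupling constant `a`)
  obtain ⟨K₁, CR₁, hK₁, hCR₁, h₁⟩ := ladder_crush_quasistatic_nu W i (W.phase j).m hhop hM hl hh hβ ha hm₂ hS₀ hMo hF
  have hhop' : ∑ a, (W.phase i).e a * ((-(W.phase j).m) a : ℝ) ≠ 0 := by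
    rw [sum_e_mul_neg]; exact neg_ne_zero.2 hhop
  have ha' : a = 2 * Real.pi * |∑ a, (W.phase i).e a * ((-(W.phase j).m) a : ℝ)| * ‖slotAmp W i‖ := by
    rw [ha, sum_e_mul_neg, abs_neg]
  obtain ⟨K₂, CR₂, hK₂, hCR₂, h₂⟩ := ladder_crush_quasistatic_nu W i (-(W.phase j).m) hhop' hM hl hh hβ ha' hm₂ hS₀ hMo hF
  refine ⟨max K₁ K₂, max CR₁ CR₂, lt_max_of_lt_left hK₁, lt_max_of_lt_left hCR₁, ?_⟩
  intro R hMR r hr hr1 hbox hτ 𝔸 h𝔸 hodd γ₁ hγ₁ p z₀ hz₀ u hu hu0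
  have hr3 : 0 ≤ r ^ 3 := by positivity
  -- the unshifted pair crush
  have key : ∀ v : ℝ → Space R,
      (∀ t ∈ Icc ((W.stretch (1 / r ^ 3) (by positivity)).start i) ((W.stretch (1 / r ^ 3) (by positivity)).start i + 1 / r ^ 3 * (W.phase i).τ),
        HasDerivAt v (((gen (W.stretch (1 / r ^ 3) (by positivity)) 𝔸 γ₁ R t).restrictScalars ℝ) (v t)) t) →
      v ((W.stretch (1 / r ^ 3) (by positivity)).start i) ∈ ladderSub R (ladder z₀ (W.phase i).m) →
      ‖v ((W.stretch (1 / r ^ 3) (by positivity)).start i + 1 / r ^ 3 * (W.phase i).τ)‖ ^ 2 ≤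
        max K₁ K₂ * r ^ 3 * ‖v ((W.stretch (1 / r ^ 3) (by positivity)).start i)‖ ^ 2 := by
    intro v hvd hv0
    rcases hz₀ with hz | hz
    · rw [hz] at hv0
      exact (h₁ hMR hr hr1 ((le_max_left _ _).trans hbox) hτ h𝔸 hodd hγ₁ hvd hv0).trans
        (mul_le_mul_of_nonneg_right (mul_le_mul_of_nonneg_right (le_max_left _ _) hr3) (sq_nonneg _))
    · rw [hz] at hv0
      exact (h₂ hMR hr hr1 ((le_max_right _ _).trans hbox) hτ h𝔸 hodd hγ₁ hvd hv0).trans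
        (mul_le_mul_of_nonneg_right (mul_le_mul_of_nonneg_right (le_max_right _ _) hr3) (sq_nonneg _))
  -- the time shift by `p` periods: `σ ↦ u (σ + pP)` solves the same equation on the unshifted window
  have hvd : ∀ t ∈ Icc ((W.stretch (1 / r ^ 3) (by positivity)).start i) ((W.stretch (1 / r ^ 3) (by positivity)).start i + 1 / r ^ 3 * (W.phase i).τ),
      HasDerivAt (fun σ => u (σ + p * (W.stretch (1 / r ^ 3) (by positivity)).period))
        (((gen (W.stretch (1 / r ^ 3) (by positivity)) 𝔸 γ₁ R t).restrictScalars ℝ)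
          (u (t + p * (W.stretch (1 / r ^ 3) (by positivity)).period))) t := by
    intro t ht
    have h := hu (t + p * (W.stretch (1 / r ^ 3) (by positivity)).period) ⟨by linarith [ht.1], by linarith [ht.2]⟩
    have h' := HasDerivAt.comp_add_const t (p * (W.stretch (1 / r ^ 3) (by positivity)).period) h
    rw [gen_add_int_mul_period] at h'
    exact h'
  have h := key _ hvd hu0
  rw [add_right_comm] at h
  exact h


/-! ## §3 The ν-crushed periodic response of the stretched word -/

/-- **THE ν-CRUSHED PERIODIC RESPONSE.**  Word `W`, hopping slot `i` for the source fibres `± m_j` (`êᵢ·m_j ≠ 0`), feasible window shape `(l, h, β)`: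
ν-free `K, C_R > 0` such that for every admissible `R, r, 𝔸 ∈ NearIso(r³l, r³h) ∩ OddSmall(r³β)`, `γ₁ > 0`, integer shift `p`, with
`W₁ = W.stretch (1/r³)`, `s = start¹ᵢ + pP¹`, `e = s + τᵢ/r³`, `N̄ = responseExt W₁ 𝔸 γ₁ R j`, any source time `a ≤ s` with `e ≤ a + P¹`, STATIC links on
`[a, s)` (`hstatic`) and the source of `j` OFF on `[s, a + P¹]` (`hsrc`), and any `θ < 1` above `e^{−min(γ₁,4π²r³l)(P¹ − τᵢ/r³)}`:
`‖N̄ e v‖ ≤ 2√(K r³)/(1 − θ) · ‖N̄ s v‖`.  (`…CrushedResponse` §4 with `κ = K r³` from `ladderCrush_pair_shifted`; only slot `i` is active on its closed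
shifted window.) [cite: BedrossianCotiZelati2017, §2 (hypocoercivity, enhanced dissipation)] [cite: SandersVerhulstMurdock2007, Lemma 5.2.7 (linear case)] -/
theorem norm_responseExt_le_crushed_nu (W : LatticeWord k₀) (i j : Fin k₀)
    (hhop : ∑ a, (W.phase i).e a * ((W.phase j).m a : ℝ) ≠ 0) {M : ℝ} (hM : ∀ c, |((W.phase i).m c : ℝ)| ≤ M)
    {l h β : ℝ} (hl : 0 < l) (hh : 0 < h) (hβ : 0 ≤ β)
    {a m₂ S₀ Mo : ℝ} (ha : a = 2 * Real.pi * |∑ a, (W.phase i).e a * ((W.phase j).m a : ℝ)| * ‖slotAmp W i‖)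
    (hm₂ : m₂ = freqNormSq (W.phase i).m)
    (hS₀ : S₀ = 4 * (4 * a ^ 2) + 16 * (8 * a ^ 2 * (1 + m₂) * h / l) + 1) (hMo : Mo = 8 * a ^ 2 * (1 + m₂))
    (hF : 128 * (β / (2 * l) * (1 + Mo)) ^ 2 ≤ S₀) :
    ∃ K CR : ℝ, 0 < K ∧ 0 < CR ∧
      ∀ {R : ℕ}, M < R → ∀ {r : ℝ} (hr : 0 < r), r ≤ 1 → CR ≤ ((R : ℝ) - M) * r ^ 2 → 2 * r ^ 2 ≤ (W.phase i).τ →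
      ∀ {𝔸 : Torus.Visc4 (Fin 3)}, Torus.NearIso 𝔸 (r ^ 3 * l) (r ^ 3 * h) → Torus.OddSmall 𝔸 (r ^ 3 * β) → ∀ {γ₁ : ℝ}, 0 < γ₁ →
      ∀ (p : ℤ) (v : EuclideanSpace ℂ (Fin 3)) {a₀ : ℝ},
        a₀ ≤ (W.stretch (1 / r ^ 3) (by positivity)).start i + p * (W.stretch (1 / r ^ 3) (by positivity)).period →
        (W.stretch (1 / r ^ 3) (by positivity)).start i + p * (W.stretch (1 / r ^ 3) (by positivity)).period + 1 / r ^ 3 * (W.phase i).τ ≤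
          a₀ + (W.stretch (1 / r ^ 3) (by positivity)).period →
        (∀ t ∈ Ico a₀ ((W.stretch (1 / r ^ 3) (by positivity)).start i + p * (W.stretch (1 / r ^ 3) (by positivity)).period),
          ∀ (l' : Fin k₀) (z : box R), (z : Fin 3 → ℤ) ≠ (W.phase j).m → (z : Fin 3 → ℤ) ≠ -(W.phase j).m →
          ∀ w : Fin 3 → ℤ, (w = z.1 - (W.phase l').m ∨ w = z.1 + (W.phase l').m) → w ∈ box R →
          (w = (W.phase j).m ∨ w = -(W.phase j).m) → linkCoeff (W.stretch (1 / r ^ 3) (by positivity)) 1 z.1 l' t = 0) →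
        (∀ t ∈ Icc ((W.stretch (1 / r ^ 3) (by positivity)).start i + p * (W.stretch (1 / r ^ 3) (by positivity)).period)
          (a₀ + (W.stretch (1 / r ^ 3) (by positivity)).period), slotEnvelope (W.stretch (1 / r ^ 3) (by positivity)) j t = 0) →
        ∀ {θ : ℝ}, Real.exp (-(min γ₁ (4 * Real.pi ^ 2 * (r ^ 3 * l)) *
            ((W.stretch (1 / r ^ 3) (by positivity)).period - (1 / r ^ 3 * (W.phase i).τ)))) ≤ θ → θ < 1 →
        ‖responseExt (W.stretch (1 / r ^ 3) (by positivity)) 𝔸 γ₁ R j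
            ((W.stretch (1 / r ^ 3) (by positivity)).start i + p * (W.stretch (1 / r ^ 3) (by positivity)).period + 1 / r ^ 3 * (W.phase i).τ) v‖ ≤
          2 * Real.sqrt (K * r ^ 3) / (1 - θ) *
            ‖responseExt (W.stretch (1 / r ^ 3) (by positivity)) 𝔸 γ₁ R j
              ((W.stretch (1 / r ^ 3) (by positivity)).start i + p * (W.stretch (1 / r ^ 3) (by positivity)).period) v‖ := by
  obtain ⟨K, CR, hK, hCR, hpair⟩ := ladderCrush_pair_shifted W i j hhop hM hl hh hβ ha hm₂ hS₀ hMo hF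
  refine ⟨K, CR, hK, hCR, ?_⟩
  intro R hMR r hr hr1 hbox hτ 𝔸 h𝔸 hodd γ₁ hγ₁ p v a₀ has heP hstatic hsrc θ hθ hθ1
  have hr3 : 0 < r ^ 3 := by positivity
  have hτ0 : 0 < (W.phase i).τ := (W.phase i).τ_pos
  have hse : (W.stretch (1 / r ^ 3) (by positivity)).start i + p * (W.stretch (1 / r ^ 3) (by positivity)).period ≤
      (W.stretch (1 / r ^ 3) (by positivity)).start i + p * (W.stretch (1 / r ^ 3) (by positivity)).period + 1 / r ^ 3 * (W.phase i).τ :=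
    le_add_of_nonneg_right (by positivity)
  -- only slot `i` is active on its closed shifted window
  have hoff : ∀ t ∈ Icc ((W.stretch (1 / r ^ 3) (by positivity)).start i + p * (W.stretch (1 / r ^ 3) (by positivity)).period)
      ((W.stretch (1 / r ^ 3) (by positivity)).start i + p * (W.stretch (1 / r ^ 3) (by positivity)).period + 1 / r ^ 3 * (W.phase i).τ),
      ∀ l', l' ≠ i → slotEnvelope (W.stretch (1 / r ^ 3) (by positivity)) l' t = 0 :=
    fun t ht l' hl' => slotEnvelope_eq_zero_of_mem_shifted_slot_Icc (W.stretch (1 / r ^ 3) (by positivity)) hl' p ht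
  have h := norm_responseExt_le_of_ladderCrush' (W.stretch (1 / r ^ 3) (by positivity)) h𝔸 (by positivity) hγ₁ R j i v has hse heP
    hstatic hsrc hoff (κ := K * r ^ 3) (by positivity)
    (fun z₀ hz₀ u hu hu0 => hpair hMR hr hr1 hbox hτ h𝔸 hodd hγ₁.le p z₀ hz₀ u hu hu0) (θ := θ) ?_ hθ1
  · exact h
  · -- `P¹ − (e − s) = P¹ − τᵢ/r³`
    have e1 : (W.stretch (1 / r ^ 3) (by positivity : (0:ℝ) < 1 / r ^ 3)).period -
        ((W.stretch (1 / r ^ 3) (by positivity : (0:ℝ) < 1 / r ^ 3)).start i + p * (W.stretch (1 / r ^ 3) (by positivity : (0:ℝ) < 1 / r ^ 3)).period +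
          1 / r ^ 3 * (W.phase i).τ -
          ((W.stretch (1 / r ^ 3) (by positivity : (0:ℝ) < 1 / r ^ 3)).start i + p * (W.stretch (1 / r ^ 3) (by positivity : (0:ℝ) < 1 / r ^ 3)).period)) =
        (W.stretch (1 / r ^ 3) (by positivity : (0:ℝ) < 1 / r ^ 3)).period - 1 / r ^ 3 * (W.phase i).τ := by ring
    rw [e1]
    exact hθ

end Summit.AnomalousDissipation.AnomalousDissipation.Theorems.SolenoidalFractalHomogenisation.LagrangianStep.Sideband

end
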